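import Literature.NumberTheory.Automorphic.HeckeDoubleCosetOperators
import HarnessLib

/-!
# R90 · S6 «Ch. 14.1–14.5 stable trace formula» — WAVE 7 card W7-a.2: the index `#(KgK ∕ K)` is transported by any
# group isomorphism respecting the `K`-laws (`Theorems/R90S6OrbitNcardMulEquiv.lean`)

Cell `hodgecm-mathlib`, crux H413 (`stmt-HodgeConjecture-24833`), route of record `HCCMUnconditional`; programme R90-TF,
section S6 (base `R90-C14`), seat R90-C14-p06 (g0); S6 WAVE 7 (R90-C14-plan (g2), R90 bus 2026-09-04T23:08:14Z ∕ 23:10:40Z ∕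
23:14:13Z), card W7-a.2 of the typist's sheet `R90/R90-C14-typ1/g2/S6_wave7_targets.v1.712f4079a2a1dc1c.lean` :79–:82
(HETERO form `θ : G ≃* G'`, dealer «=» 23:10:40Z; signature token-identical; namespace segment `.Wave7` dropped, as for W3∕W6).
Helper lane `--supports stmt-HodgeConjecture-24833 --as helper`; THEOREMS ONLY (no definition, no instance, no notation, no named
fact, no `sorry`); imports = ★ `Literature.NumberTheory.Automorphic.HeckeDoubleCosetOperators` + HarnessLib (no Lines import).

CONTENT (pure group theory).  A group isomorphism `θ : G ≃* G'` with the `K`-law `θ g ∈ K' ↔ g ∈ K` induces the INJECTIVE map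
`φ : gK ↦ θ(g)K'` of `G ⧸ K` into `G' ⧸ K'` (well defined and injective by the `K`-law: `a⁻¹ b ∈ K ↔ θ(a)⁻¹ θ(b) ∈ K'`), which
carries the `K`-orbit of `gK` ONTO the `K'`-orbit of `θ(g)K'` (`κ gK ↦ θ(κ) θ(g)K'`, and `κ' ∈ K'` is `θ(θ⁻¹ κ')` with `θ⁻¹ κ' ∈ K`).
Hence the indices `#(K' θ(g) K' ∕ K')` and `#(KgK ∕ K)` agree — with NO finiteness guard: `Set.ncard` is invariant under injective
images (`Set.ncard_image_of_injective`; an infinite orbit has `ncard 0` on both sides).  Second of the four «eG-independence»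
lemmas (W7-a.1…a.4); the endo form `G' = G`, `K' = K` feeds W7-a.3, the hetero form serves the W7-e transports lattice-model ↔ `U`.
★ API used: `mem_orbit_mk_iff` (HeckeGelfandTrick), Mathlib `Quotient.map'`, `QuotientGroup.leftRel_apply`, `QuotientGroup.eq`,
`QuotientGroup.mk_surjective`, `Set.ncard_image_of_injective`.

* **`ncard_orbit_mk_mulEquiv_eq`** — W7-a.2.

HONEST LABEL: a helper theorem, count-neutral until the E1.3.9 assembly consumes W7-a.4; HC_CM is proved only modulo the
7 printed citations (2 remaining named inputs: hLiu418 = stmt-HodgeConjecture-24832, h413 = stmt-HodgeConjecture-24833)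
until rung 0 closes; REL ≠ ★ ≠ BUILT.

## References
* [ShimuraIATAF1971] G. Shimura, *Introduction to the arithmetic theory of automorphic functions* (1971), §3.1 (double cosets
  `KgK = ⊔ g_i K`, `deg KgK = #(KgK ∕ K)`).
* [CartierCorvallis1979] P. Cartier, *Representations of 𝔭-adic groups: a survey*, PSPM 33.1 (1979), §I.3–I.4.
-/

set_option autoImplicit false
-- the mandated namespace repeats the single-problem summit's segment (`HodgeConjecture.HodgeConjecture`)
set_option linter.dupNamespace false

noncomputable section

open MulAction
open Literature.NumberTheory.Automorphic

namespace Summit.HodgeConjecture.HodgeConjecture.R90.S6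

/-- **W7-a.2** `ncard_orbit_mk_mulEquiv_eq` (hetero form; the dealer's endo form is `G' = G`, `K' = K`): a group isomorphism
`θ : G ≃* G'` with `θ g ∈ K' ↔ g ∈ K` induces the injection `gK ↦ θ(g)K'` of `G ⧸ K` into `G' ⧸ K'` carrying the `K`-orbit of
`gK` onto the `K'`-orbit of `θ(g)K'`; hence the indices `#(K' θ(g) K' ∕ K') = #(KgK ∕ K)` agree.  No finiteness guard:
`Set.ncard` is invariant under injective images (infinite orbits on both sides give `0`). [folklore] -/
theorem ncard_orbit_mk_mulEquiv_eq {G G' : Type*} [Group G] [Group G'] (K : Subgroup G) (K' : Subgroup G') (θ : G ≃* G')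
    (hθ : ∀ g, θ g ∈ K' ↔ g ∈ K) (g : G) :
    (orbit K' ((θ g : G') : G' ⧸ K')).ncard = (orbit K (g : G ⧸ K)).ncard := by
  -- the `K`-law makes `gK ↦ θ(g)K'` a well-defined map `φ : G ⧸ K → G' ⧸ K'` …
  obtain ⟨φ, hφ⟩ : ∃ φ : G ⧸ K → G' ⧸ K', ∀ a : G, φ (a : G ⧸ K) = ((θ a : G') : G' ⧸ K') :=
    ⟨Quotient.map' (θ : G → G') fun a b h => QuotientGroup.leftRel_apply.2
        (by rw [← map_inv, ← map_mul]; exact (hθ _).2 (QuotientGroup.leftRel_apply.1 h)),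
      fun _ => rfl⟩
  -- … which is injective …
  have hinj : Function.Injective φ := by
    intro x y hxy
    obtain ⟨a, rfl⟩ := QuotientGroup.mk_surjective x
    obtain ⟨b, rfl⟩ := QuotientGroup.mk_surjective y
    rw [hφ, hφ, QuotientGroup.eq, ← map_inv, ← map_mul, hθ] at hxy
    exact QuotientGroup.eq.2 hxy
  -- … and carries the `K`-orbit of `gK` onto the `K'`-orbit of `θ(g)K'`
  have himg : φ '' orbit K (g : G ⧸ K) = orbit K' ((θ g : G') : G' ⧸ K') := by
    ext γ
    constructor
    · rintro ⟨x, hx, rfl⟩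
      obtain ⟨κ, rfl⟩ := (mem_orbit_mk_iff K).1 hx
      exact (mem_orbit_mk_iff K').2 ⟨⟨θ κ, (hθ _).2 κ.2⟩, by rw [hφ, map_mul]⟩
    · intro hγ
      obtain ⟨κ', rfl⟩ := (mem_orbit_mk_iff K').1 hγ
      refine ⟨((θ.symm κ' * g : G) : G ⧸ K), (mem_orbit_mk_iff K).2 ⟨⟨θ.symm κ', ?_⟩, rfl⟩, ?_⟩
      · rw [← hθ, MulEquiv.apply_symm_apply]
        exact κ'.2
      · rw [hφ, map_mul, MulEquiv.apply_symm_apply]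
  rw [← himg, Set.ncard_image_of_injective _ hinj]

end Summit.HodgeConjecture.HodgeConjecture.R90.S6

end
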